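import Summits.CriticalPhenomena.PercolationContinuityZ3.Theorems.Transplant.FKConnectivityAllQAntipodalTwoSpineGround
import Summits.CriticalPhenomena.PercolationContinuityZ3.Theorems.Transplant.FKConnectivityAllQAntipodalTwoSpineNoCollision
import HarnessLib

/-!
# Connectivity correlation inequalities for `φ_{w,q}` — TWO-SPINE word model: `phiRun` TURNS A `01`-SIDE INTO A `10`-SIDE (non-critical case)

Helper file (`--supports stmt-CriticalPhenomena-4575`), FK sub-lane `prim-bschramm-fk-2` (gen 15); builds on p205010 (kernel theorem,
internal audit signed; external expert review pending).  No named facts, no sorries, standard axioms.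

Memo `bschramm/FROM-fk-2-g15-TWO-SPINE.md` §12 (V1) / blueprint L2.3: the word-level 'winner' property of Theorem U's injection.  `topComp r w`
is the two-terminal type of the whole side (the outermost composite `M_K`).  **`topComp_phiRun`**: if the side is of type `01` and the run does
NOT reach the root (non-critical), then after `phiRun` the side is of type `10` — it conducts in `γ` and fails in `γᶜ`.  Ingredients: inside the
run every letter is `01` or inert (`run_letter`); once a composite is `10`, letters `10`/inert keep it `10`; at the bottom of a run that stops
above the root the new composite is `10`; a run through a ground tail produces an anti-ground tail (`…TwoSpineGround`, `…TwoSpineNoCollision`).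
[cite: Grimmett2006, §3.8 (pp. 61–62); §3.9 (p. 63)]
-/

namespace Summit.CriticalPhenomena.PercolationContinuityZ3.Theorems

namespace FK

namespace TwoSpine

open X2Word

/-- The type of the whole side: the outermost composite `M_K` (the root type for the empty word). [folklore] -/
def topComp (r : Bool × Bool) (w : List SLetter) : Bool × Bool := w.foldl compStep r

/-- `topComp` of a `cons` is `topComp` of the tail from the first composite. [folklore] -/
@[simp] theorem topComp_cons (r : Bool × Bool) (l : SLetter) (w : List SLetter) :
    topComp r (l :: w) = topComp (compStep r l) w := rfl

/-- `topComp` of the empty word is the root type. [folklore] -/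
@[simp] theorem topComp_nil (r : Bool × Bool) : topComp r [] = r := rfl

/-- `phiReachesRoot` of a `cons`, unfolded one step: the root is reached iff the root is `01` and the run from `M_1` reaches `M_1`. [folklore] -/
theorem phiReachesRoot_cons (r : Bool × Bool) (l : SLetter) (w : List SLetter) :
    phiReachesRoot r (l :: w) = (is01 r && phiReachesRoot (compStep r l) w) := by
  simp [phiReachesRoot, comps, allAbove]

/-- `phiRun` on a `cons` in terms of `phiReachesRoot` of the tail: the innermost letter is flipped iff the run reaches `M_1` (all of
`M_1, …, M_K` are `01`) and the letter is `01`. [folklore] -/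
theorem phiRun_cons' (r : Bool × Bool) (l : SLetter) (w : List SLetter) :
    phiRun r (l :: w) =
      (if phiReachesRoot (compStep r l) w && (l.2 == (false, true)) then (l.1, true, false) else l) :: phiRun (compStep r l) w := by
  rw [phiRun_cons]; rfl

/-- Through an anti-ground word a `10` composite stays `10`. [folklore] -/
theorem topComp_present_antiGround {w : List SLetter} (hw : isAntiGround w = true) : topComp (true, false) w = (true, false) := by
  induction w with
  | nil => rfl
  | cons l w ih =>
    have hl : antiGroundLetter l = true := by simp [isAntiGround] at hw; exact hw.1
    have hw' : isAntiGround w = true := by simp [isAntiGround] at hw ⊢; exact hw.2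
    rw [topComp_cons, compStep_present_antiGround hl, ih hw']

/-- The letterwise swap of a ground word is anti-ground. [folklore] -/
theorem isAntiGround_swap_of_ground {w : List SLetter} (hw : isGround w = true) :
    isAntiGround (w.map (fun l => if l.2 == (false, true) then (l.1, true, false) else l)) = true := by
  induction w with
  | nil => rfl
  | cons l w ih =>
    have hl : groundLetter l = true := by simp [isGround] at hw; exact hw.1
    have hw' : isGround w = true := by simp [isGround] at hw ⊢; exact hw.2
    simp only [List.map_cons, isAntiGround, List.all_cons, Bool.and_eq_true]
    refine ⟨?_, by simpa [isAntiGround] using ih hw'⟩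
    obtain ⟨k, b, bb⟩ := l
    cases k <;> cases b <;> cases bb <;> simp_all [groundLetter, antiGroundLetter]

/-- A type with `is01 = true` is `(false, true)`. [folklore] -/
theorem eq_of_is01 {c : Bool × Bool} (h : is01 c = true) : c = (false, true) := by
  obtain ⟨c1, c2⟩ := c
  cases c1 <;> cases c2 <;> simp_all [is01]

/-- If a single step from a non-`01` root gives a `01` composite, the letter is `λ = 01` and flipping it gives a `10` composite. [folklore] -/
theorem compStep_01_of_not01 {r : Bool × Bool} {l : SLetter} (hr : is01 r = false) (hc : compStep r l = (false, true)) :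
    l.2 = (false, true) ∧ compStep r (l.1, true, false) = (true, false) := by
  obtain ⟨r1, r2⟩ := r
  obtain ⟨k, b, bb⟩ := l
  cases k <;> cases r1 <;> cases r2 <;> cases b <;> cases bb <;> simp_all [compStep, is01]

/-- **`phiRun` turns a `01`-side into a `10`-side** when the run does not reach the root (the non-critical case of the two-spine rule;
memo §12 V1: the flipped side conducts in `γ` and fails in `γᶜ`, so `Φ_N(ℓ)` is a winner). [folklore] -/
theorem topComp_phiRun {r : Bool × Bool} {w : List SLetter} (h01 : topComp r w = (false, true)) (hnr : phiReachesRoot r w = false) :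
    topComp r (phiRun r w) = (true, false) := by
  induction w generalizing r with
  | nil =>
    simp only [topComp_nil] at h01
    subst h01
    simp [phiReachesRoot, is01, comps, allAbove] at hnr
  | cons l w ih =>
    rw [phiRun_cons', topComp_cons]
    rw [phiReachesRoot_cons] at hnr
    rw [topComp_cons] at h01
    rcases Bool.eq_false_or_eq_true (phiReachesRoot (compStep r l) w) with hreach | hreach
    · -- the run reaches `M_1`: the root is not `01`, the innermost letter is `λ` and is flipped; the tail is ground ↦ anti-ground
      have hr : is01 r = false := by simpa [hreach] using hnr
      have hi : is01 (compStep r l) = true := by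
        have h := hreach
        simp only [phiReachesRoot, Bool.and_eq_true] at h
        exact h.1
      have hc01 : compStep r l = (false, true) := eq_of_is01 hi
      obtain ⟨hl, hflip⟩ := compStep_01_of_not01 hr hc01
      have hground : isGround w = true := by rw [← phiReachesRoot_absent_iff]; rwa [hc01] at hreach
      rw [hreach, hl]
      simp only [beq_self_eq_true, Bool.and_self, if_true]
      rw [hflip, hc01, phiRun_absent_ground hground]
      exact topComp_present_antiGround (isAntiGround_swap_of_ground hground)
    · -- the run stops above `M_1`: the innermost letter is kept, recurse
      rw [hreach]
      simp only [Bool.false_and, Bool.false_eq_true, if_false]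
      exact ih h01 hreach

end TwoSpine

end FK

end Summit.CriticalPhenomena.PercolationContinuityZ3.Theorems
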